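import Summits.BirchSwinnertonDyer.BirchSwinnertonDyer.Theorems.AlignedTransportAtTwoMainConjectureOfRankZeroBSDAtTwoSeed
import Summits.BirchSwinnertonDyer.Rank1Residual.X5.KatoOrdTwoMuPart
import HarnessLib

/-!
# Route `AlignedTransportAtTwo`, crux C2 `MainConjectureOfRankZeroBSDAtTwo` (stmt-BirchSwinnertonDyer-22298):
# ROAD (c) — the crux IS Kato's missing `𝔭 = (2)` clause on the seed cell, BY NAME

HONEST FRAMING (cell `bsd-f1-sign2`, HOME `run/shared/lean/pub/bsd-f1-sign2/`, lead prover seat `bsd-line-att-p2`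
gen 3, line `birth`; BSD is NOT proved by any of this; no theorem beyond print). THEOREMS ONLY — no definition,
nothing asserted; every deep input is DISPLAYED as a hypothesis which is a PUBLISHED named fact of the tree
(`h17` Kato 2004 Thm. 17.4 (1)(2) at `2`, `hGr` Greenberg 1999 Thm. 4.1 parity-free, `hper` the period unit at `2`,
`hmod` modularity, `hGZK` Gross–Zagier–Kolyvagin) or the displayed non-print input of the road.

ROAD (c). Cell `bsd-2adic` typed the one clause of Kato's divisibility that is not a theorem in print at a good
ordinary `2` — the `𝔭 = (2)` clause of Astérisque 295 Thm. 12.5 (4) / 13.4 (3) / 17.4 (3) («Assume further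
`p ≠ 2`», p. 226) — as the per-curve `@[conjecture]` obligation `X5.O1.KatoMuPartAtTwo W`
(`2^{μ(X(E/ℚ_∞))} ∣ L₀` for every integral `L₀` with `ι L₀ = ϖ·L₂(f, α)`; file `X5/KatoOrdTwoMuPart.lean`). This
file proves that ON THE SEED CELL of route `AlignedTransportAtTwo` the crux C2 is EQUIVALENT, modulo PRINT, to
that obligation:

* `mu_eq_zero_of_katoMuPartAtTwo` (per curve): period unit + modularity + good ordinary `2` + no rational point of
  order `2` + the crux's ANALYTIC binder `μ(L₂(f, α)) = 0` + `KatoMuPartAtTwo W` ⟹ `μ(X(W/ℚ_∞)) = 0` at every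
  cyclotomic dual datum — here the analytic binder is LOAD-BEARING (it is idle on road (a));
* `katoMuPartAtTwo_of_mu_eq_zero_of_isTorsion` (per curve): Kato 17.4 (1) at `2` + `μ = 0` on torsion data ⟹
  `KatoMuPartAtTwo W`;
* `mainConjectureOfRankZeroBSDAtTwo_of_seedKatoMuPartAtTwo`: PRINT + «`KatoMuPartAtTwo W` for every seed-cell
  curve» ⟹ C2 BY NAME (through the gen-0 kernel `mainConjectureOfRankZeroBSDAtTwo_of_seedMuZero`);
* `seedKatoMuPartAtTwo_of_mainConjectureOfRankZeroBSDAtTwo` and `mainConjectureOfRankZeroBSDAtTwo_iff_seedKatoMuPartAtTwo`: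
  the converse and the equivalence modulo PRINT.

So the residual of cell `bsd-2adic` at good ordinary `2` (class O1) and the seed crux of cell `bsd-f1-sign2`
coincide BY NAME on the seed cell. Where print stops (read first-hand, 2026-08-28): Kato's Euler-system paper
[Kodai Math. J. 22 (1999)] Prop. 10.5 (4), p. 356 — for `p = 2` the ring `Λ = O[[Gal(ℚ(ζ_{2^∞})/ℚ)]]` has NO
height-one prime `𝔭 ∋ 2` with `Λ_𝔭` a discrete valuation ring (complex conjugation has order `2`), so Thm. 0.8
there is empty at `𝔭 ∋ 2`; this is the source of «assume further `p ≠ 2`» in Astérisque 295 Thm. 13.4 (3).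

References: K. Kato, Astérisque 295 (2004), Thm. 12.5 (4) p. 222, Thm. 13.4 (3) p. 226, Thm. 17.4 p. 273;
K. Kato, Kodai Math. J. 22 (1999) 313–372, Thm. 0.8, Prop. 10.5 (4) p. 356; R. Greenberg, LNM 1716 (1999),
Conj. 1.11, Thm. 4.1; R. Greenberg, V. Vatsal, Invent. Math. 142 (2000), p. 4.
-/

set_option linter.dupNamespace false
set_option autoImplicit false

noncomputable section

open scoped Classical MatrixGroups ModularForm

open CongruenceSubgroup WeierstrassCurve Literature.NumberTheory.EllipticCurves
  Literature.NumberTheory.EllipticCurves.ModularForms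
  Literature.NumberTheory.EllipticCurves.Rank1Residual
  Literature.NumberTheory.EllipticCurves.Greenberg1999
  Summit.BirchSwinnertonDyer.Rank1Residual
  Summit.BirchSwinnertonDyer.Rank1Residual.X1.MuLambda
  Summit.BirchSwinnertonDyer.Rank1Residual.X1.MuPart
  Summit.BirchSwinnertonDyer.Rank1Residual.X5
  Summit.BirchSwinnertonDyer.Rank1Residual.F1Sign2
  Summit.BirchSwinnertonDyer.BirchSwinnertonDyer.Theorems.Rank1ResidualX1Defs
  Summit.BirchSwinnertonDyer.BirchSwinnertonDyer.Theses.AlignedTransportAtTwo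
  Summit.BirchSwinnertonDyer.BirchSwinnertonDyer.Theorems.AlignedTransportAtTwoSeed

namespace Summit.BirchSwinnertonDyer.BirchSwinnertonDyer.Theorems.AlignedTransportAtTwoKatoMuRoad

/-! ## §1 Per curve: the `𝔭 = (2)` clause + the analytic binder ⟹ `μ₂(X) = 0`; and back -/

section PerCurve

variable (W : WeierstrassCurve ℚ) [W.IsElliptic] [W.IsGloballyMinimal]

/-- **ROAD (c), per curve.** Let `W/ℚ` be globally minimal, good ordinary at `2`, with no rational point of order
`2`. Granted PRINT — the period unit at `2` (`hper`) and modularity (`hmod`) — the crux's analytic binder (`hμan`: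
every even-branch integral lift `G` has `red G ≠ 0`) and the typed `𝔭 = (2)` clause of Kato's divisibility
`X5.O1.KatoMuPartAtTwo W` (`hK`) give `μ(X(W/ℚ_∞)) = 0` at every cyclotomic dual datum. Proof: the conductor-level
newform `f` (`hmod`), the Néron ratio `ϖ = u⁻¹ ∈ ℤ₂ˣ` (`hper`), the integral lift `G` of `L₂(f, α)` (exists for `E[2]`
irreducible), `L₀ = ϖ·G ∈ Λ`; `hK` gives `2^{μ(X)} ∣ L₀`, and `μ(L₀) = μ(G) = 0`.
[cite: Kato2004Asterisque, Thm. 13.4 (3) (p. 226) and Thm. 17.4 (3) (p. 273) (shape of the missing clause)]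
[cite: GreenbergVatsal2000, p. 4] [cite: AbbesUllmo1996, Thm. A] -/
theorem mu_eq_zero_of_katoMuPartAtTwo (hper : realPeriodRat_eq_unit_mul_plusPeriod_two)
    (hmod : nonempty_modularParametrizationData) (hord : IsOrdinaryAt W 2)
    (ht : ∀ x : ℚ, ¬ HasRationalTwoTorsionX W x)
    (hμan : ∀ ⦃N : ℕ⦄ [NeZero N] (f : CuspForm (Gamma0 N) 2), IsNewformOf W f →
      ∀ G : IwasawaAlgebra 2, IsEvenBranchLiftAtTwo W f G → red G ≠ 0)
    (hK : O1.KatoMuPartAtTwo W) :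
    ∀ (κ : ZpExtension ℚ 2) (γ : Field.absoluteGaloisGroup ℚ), κ.IsCyclotomic →
      κ.IsTopGenerator γ → IsCyclotomicVariable 2 γ → ∀ D : W.SelmerDualData κ γ, D.mu = 0 := by
  intro κ γ hκ hγ hγ' D
  have hirr : Irr W 2 := irr_two_of_forall_not_hasRationalTwoTorsionX W ht
  haveI : NeZero (W.conductorNorm ℤ) := ⟨(W.conductorNorm_pos_holds).ne'⟩
  obtain ⟨Dm⟩ := hmod W
  have hf : IsNewformOf W Dm.f := Dm.isNewformOf
  -- the Néron ratio `ϖ = u⁻¹`, a `2`-adic unit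
  obtain ⟨u, hu, hΩ⟩ := hper W hord.1 hirr Dm.f hf
  have hΩpos : 0 < W.realPeriodRat := W.realPeriodRat_pos_holds
  have hu0 : u ≠ 0 := by
    rintro rfl
    rw [Rat.cast_zero, zero_mul] at hΩ
    exact hΩpos.ne' hΩ
  set ϖ : ℚ := u⁻¹ with hϖ_def
  have hϖ : (ϖ : ℝ) * W.realPeriodRat = plusPeriod Dm.f := by
    rw [hΩ, hϖ_def, Rat.cast_inv, ← mul_assoc, inv_mul_cancel₀ (by exact_mod_cast hu0), one_mul]
  have hϖnorm : ‖(ϖ : ℚ_[2])‖ = 1 := by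
    rw [hϖ_def, Rat.cast_inv, norm_inv, hu, inv_one]
  -- the integral lift `G` of `L₂(f, α)` (exists: `E[2]` irreducible) has `μ(G) = 0` by `hμan`
  obtain ⟨G, hG⟩ := exists_iwasawaToPowerSeries_eq_padicLFunction_two hord hf hirr
  have hredG : red G ≠ 0 := hμan Dm.f hf G (Or.inl ⟨hord, hG⟩)
  have hG0 : G ≠ 0 := by rintro rfl; exact hredG (by simp [red])
  -- `L₀ = ϖ' · G` with `ϖ' ∈ ℤ₂ˣ` is an integral lift of `ϖ · L₂(f, α)`
  set ϖ' : ℤ_[2] := ⟨(ϖ : ℚ_[2]), hϖnorm.le⟩ with hϖ'_def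
  have hϖ'u : IsUnit ϖ' := PadicInt.isUnit_iff.mpr (by rw [hϖ'_def]; exact hϖnorm)
  have hL₀ : iwasawaToPowerSeries 2 (PowerSeries.C ϖ' * G) =
      PowerSeries.C (ϖ : ℚ_[2]) * padicLFunction Dm.f (unitRoot W 2 : ℚ_[2]) := by
    rw [map_mul, ← hG, iwasawaToPowerSeries, PowerSeries.map_C]
    rfl
  have hL₀0 : PowerSeries.C ϖ' * G ≠ 0 := mul_ne_zero (hϖ'u.map _).ne_zero hG0
  -- the `𝔭 = (2)` clause: `2^{μ(X)} ∣ L₀`, so `μ(X) ≤ μ(L₀) = μ(G) = 0`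
  have hdvd := hK κ γ hκ hγ hγ' hord Dm.f hf ϖ hϖ D (PowerSeries.C ϖ' * G) hL₀
  have hle : D.mu ≤ mu (PowerSeries.C ϖ' * G) := le_mu_of_C_pow_dvd hL₀0 hdvd
  rw [mu_C_mul_of_isUnit hϖ'u hG0, mu_eq_zero_of_red_ne_zero hredG] at hle
  exact Nat.le_zero.mp hle

/-- **Back, per curve**: Kato 17.4 (1) at `2` (`h17`: every cyclotomic `X` is `Λ`-torsion) and `μ = 0` on the
torsion data give the `𝔭 = (2)` clause `X5.O1.KatoMuPartAtTwo W` (`2⁰ = 1 ∣ L₀`; via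
`X5.O1.katoMuPartAtTwo_of_mu_eq_zero`). [cite: Kato2004Asterisque, Thm. 17.4 (1) (p. 273)] -/
theorem katoMuPartAtTwo_of_mu_eq_zero_of_isTorsion
    (h17 : ∀ [NeZero (W.conductorNorm ℤ)] (f : CuspForm (Gamma0 (W.conductorNorm ℤ)) 2),
      kato_divisibility_allPrimes W 2 (f := f))
    (hmod : nonempty_modularParametrizationData) (hord : IsOrdinaryAt W 2)
    (hμ : ∀ (κ : ZpExtension ℚ 2) (γ : Field.absoluteGaloisGroup ℚ), κ.IsCyclotomic →
      κ.IsTopGenerator γ → IsCyclotomicVariable 2 γ →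
      ∀ D : W.SelmerDualData κ γ, D.IsTorsion → D.mu = 0) :
    O1.KatoMuPartAtTwo W := by
  refine O1.katoMuPartAtTwo_of_mu_eq_zero W fun κ γ hκ hγ hγ' D => ?_
  haveI : NeZero (W.conductorNorm ℤ) := ⟨(W.conductorNorm_pos_holds).ne'⟩
  obtain ⟨Dm⟩ := hmod W
  exact hμ κ γ hκ hγ hγ' D (h17 Dm.f κ γ hκ hγ hγ' hord Dm.isNewformOf D).1

/-- **Per curve, ROAD (c) closes the seed**: PRINT (`h17`, `hGr`, `hper`, `hmod`, `hGZK`) + good ordinary `2` + no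
rational point of order `2` + `r_an = 0` + `BSD(W,2)` + the analytic binder + `X5.O1.KatoMuPartAtTwo W` ⟹ Mazur's
`2`-adic main conjecture for `W` (through `μ₂(X) = 0` and the gen-0 kernel
`mazurMainConjecture_two_of_bsdp_of_mu_eq_zero`). [cite: Kato2004Asterisque, Thm. 17.4 (p. 273)]
[cite: GreenbergLNM1716, Thm. 4.1 (p. 102)] -/
theorem mazurMainConjecture_two_of_bsdp_of_katoMuPartAtTwo
    (h17 : ∀ [NeZero (W.conductorNorm ℤ)] (f : CuspForm (Gamma0 (W.conductorNorm ℤ)) 2),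
      kato_divisibility_allPrimes W 2 (f := f))
    (hGr : Greenberg1999.thm41_charValue_rankZero_anyPrime)
    (hper : realPeriodRat_eq_unit_mul_plusPeriod_two) (hmod : nonempty_modularParametrizationData)
    (hGZK : rank_eq_analyticRank_of_analyticRank_le_one) (hord : IsOrdinaryAt W 2)
    (ht : ∀ x : ℚ, ¬ HasRationalTwoTorsionX W x) (hr : W.analyticRank = 0) (hbsd : BSDp W 2)
    (hμan : ∀ ⦃N : ℕ⦄ [NeZero N] (f : CuspForm (Gamma0 N) 2), IsNewformOf W f →
      ∀ G : IwasawaAlgebra 2, IsEvenBranchLiftAtTwo W f G → red G ≠ 0)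
    (hK : O1.KatoMuPartAtTwo W) : MazurMainConjecture W 2 :=
  mazurMainConjecture_two_of_bsdp_of_mu_eq_zero W h17 hGr hper hmod hGZK hord ht hr hbsd
    fun κ γ hκ hγ hγ' D _ => mu_eq_zero_of_katoMuPartAtTwo W hper hmod hord ht hμan hK κ γ hκ hγ hγ' D

end PerCurve

/-! ## §2 The crux BY NAME: C2 ⟺ «`KatoMuPartAtTwo W` for every seed-cell curve `W`», modulo PRINT -/

section Crux

/-- **ROAD (c): C2 from PRINT + the seed-cell `𝔭 = (2)` clause** (= the displayed road-(c) input
«`X5.O1.KatoMuPartAtTwo W` for every seed-cell curve `W`» — non-CM, good ordinary at `2`, no rational point of order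
`2`, `Δ ∉ ℚ²`, `r_an = 0`, analytic `μ₂ = 0`, `BSD(W,2)`). On this road the crux's analytic `μ₂ = 0` binder is
load-bearing. [cite: Kato2004Asterisque, Thm. 13.4 (3) (p. 226), Thm. 17.4 (p. 273)] [cite: GreenbergLNM1716, Thm. 4.1 (p. 102)] -/
theorem mainConjectureOfRankZeroBSDAtTwo_of_seedKatoMuPartAtTwo
    (h17 : ∀ (V : WeierstrassCurve ℚ) [V.IsElliptic] [V.IsGloballyMinimal] [NeZero (V.conductorNorm ℤ)]
      (f : CuspForm (Gamma0 (V.conductorNorm ℤ)) 2), kato_divisibility_allPrimes V 2 (f := f))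
    (hGr : Greenberg1999.thm41_charValue_rankZero_anyPrime)
    (hper : realPeriodRat_eq_unit_mul_plusPeriod_two) (hmod : nonempty_modularParametrizationData)
    (hGZK : rank_eq_analyticRank_of_analyticRank_le_one)
    (hK : ∀ (W : WeierstrassCurve ℚ) [W.IsElliptic] [W.IsGloballyMinimal], ¬ W.HasCM →
      IsOrdinaryAt W 2 → (∀ x : ℚ, ¬ HasRationalTwoTorsionX W x) → ¬ IsSquare W.Δ →
      W.analyticRank = 0 →
      (∀ ⦃N : ℕ⦄ [NeZero N] (f : CuspForm (Gamma0 N) 2), IsNewformOf W f →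
        ∀ G : IwasawaAlgebra 2, IsEvenBranchLiftAtTwo W f G → red G ≠ 0) →
      BSDp W 2 → O1.KatoMuPartAtTwo W) :
    MainConjectureOfRankZeroBSDAtTwo := by
  intro W _ _ hcm hord ht hsq hr hμan hbsd
  exact mazurMainConjecture_two_of_bsdp_of_katoMuPartAtTwo W (fun f => h17 W f) hGr hper hmod hGZK hord ht hr
    hbsd hμan (hK W hcm hord ht hsq hr hμan hbsd)

/-- **Converse: C2 forces the seed-cell `𝔭 = (2)` clause**, granted PRINT (`h17` for torsion, `hper`, `hmod`): the
main conjecture + the analytic binder force `μ₂(X) = 0` (gen-0 necessity `mu_eq_zero_of_mazurMainConjecture_two`),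
whence `KatoMuPartAtTwo W`. [cite: Kato2004Asterisque, Thm. 17.4 (1) (p. 273)] [cite: GreenbergVatsal2000, p. 4] -/
theorem seedKatoMuPartAtTwo_of_mainConjectureOfRankZeroBSDAtTwo
    (hper : realPeriodRat_eq_unit_mul_plusPeriod_two) (hmod : nonempty_modularParametrizationData)
    (hC2 : MainConjectureOfRankZeroBSDAtTwo) :
    ∀ (W : WeierstrassCurve ℚ) [W.IsElliptic] [W.IsGloballyMinimal], ¬ W.HasCM →
      IsOrdinaryAt W 2 → (∀ x : ℚ, ¬ HasRationalTwoTorsionX W x) → ¬ IsSquare W.Δ →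
      W.analyticRank = 0 →
      (∀ ⦃N : ℕ⦄ [NeZero N] (f : CuspForm (Gamma0 N) 2), IsNewformOf W f →
        ∀ G : IwasawaAlgebra 2, IsEvenBranchLiftAtTwo W f G → red G ≠ 0) →
      BSDp W 2 → O1.KatoMuPartAtTwo W := by
  intro W _ _ hcm hord ht hsq hr hμan hbsd
  exact O1.katoMuPartAtTwo_of_mu_eq_zero W
    (mu_eq_zero_of_mazurMainConjecture_two W hper hmod hord ht hμan (hC2 W hcm hord ht hsq hr hμan hbsd))

/-- **C2 ⟺ the seed-cell `𝔭 = (2)` clause, modulo PRINT** (`h17`, `hGr`, `hper`, `hmod`, `hGZK`): the crux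
`MainConjectureOfRankZeroBSDAtTwo` holds IF AND ONLY IF every seed-cell curve satisfies the typed residual
`X5.O1.KatoMuPartAtTwo W` of cell `bsd-2adic` (class O1). With `mainConjectureOfRankZeroBSDAtTwo_iff_seedMuZero`
(gen 0): on the seed cell {`μ₂(X) = 0`} = {Kato's `𝔭 = (2)` clause} = {C2} modulo PRINT.
[cite: Kato2004Asterisque, Thm. 13.4 (3) (p. 226), Thm. 17.4 (p. 273)] [cite: GreenbergLNM1716, Conj. 1.11 (p. 58), Thm. 4.1 (p. 102)] -/
theorem mainConjectureOfRankZeroBSDAtTwo_iff_seedKatoMuPartAtTwo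
    (h17 : ∀ (V : WeierstrassCurve ℚ) [V.IsElliptic] [V.IsGloballyMinimal] [NeZero (V.conductorNorm ℤ)]
      (f : CuspForm (Gamma0 (V.conductorNorm ℤ)) 2), kato_divisibility_allPrimes V 2 (f := f))
    (hGr : Greenberg1999.thm41_charValue_rankZero_anyPrime)
    (hper : realPeriodRat_eq_unit_mul_plusPeriod_two) (hmod : nonempty_modularParametrizationData)
    (hGZK : rank_eq_analyticRank_of_analyticRank_le_one) :
    MainConjectureOfRankZeroBSDAtTwo ↔
      ∀ (W : WeierstrassCurve ℚ) [W.IsElliptic] [W.IsGloballyMinimal], ¬ W.HasCM →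
        IsOrdinaryAt W 2 → (∀ x : ℚ, ¬ HasRationalTwoTorsionX W x) → ¬ IsSquare W.Δ →
        W.analyticRank = 0 →
        (∀ ⦃N : ℕ⦄ [NeZero N] (f : CuspForm (Gamma0 N) 2), IsNewformOf W f →
          ∀ G : IwasawaAlgebra 2, IsEvenBranchLiftAtTwo W f G → red G ≠ 0) →
        BSDp W 2 → O1.KatoMuPartAtTwo W :=
  ⟨seedKatoMuPartAtTwo_of_mainConjectureOfRankZeroBSDAtTwo hper hmod,
    mainConjectureOfRankZeroBSDAtTwo_of_seedKatoMuPartAtTwo h17 hGr hper hmod hGZK⟩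

/-- **The two displayed residuals coincide on the seed cell, modulo PRINT** (`h17`, `hper`, `hmod`): the seed-cell
`μ₂ = 0` statement (road (a), stub T of line `birth`) holds IF AND ONLY IF the seed-cell `𝔭 = (2)` clause (road (c))
does. (⇒: `katoMuPartAtTwo_of_mu_eq_zero_of_isTorsion`; ⇐: `mu_eq_zero_of_katoMuPartAtTwo`, which uses the cell's
analytic binder.) [cite: Kato2004Asterisque, Thm. 17.4 (1) (p. 273)] [cite: GreenbergLNM1716, Conj. 1.11 (p. 58)] -/
theorem seedMuZero_iff_seedKatoMuPartAtTwo
    (h17 : ∀ (V : WeierstrassCurve ℚ) [V.IsElliptic] [V.IsGloballyMinimal] [NeZero (V.conductorNorm ℤ)]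
      (f : CuspForm (Gamma0 (V.conductorNorm ℤ)) 2), kato_divisibility_allPrimes V 2 (f := f))
    (hper : realPeriodRat_eq_unit_mul_plusPeriod_two) (hmod : nonempty_modularParametrizationData) :
    (∀ (W : WeierstrassCurve ℚ) [W.IsElliptic] [W.IsGloballyMinimal], ¬ W.HasCM →
        IsOrdinaryAt W 2 → (∀ x : ℚ, ¬ HasRationalTwoTorsionX W x) → ¬ IsSquare W.Δ →
        W.analyticRank = 0 →
        (∀ ⦃N : ℕ⦄ [NeZero N] (f : CuspForm (Gamma0 N) 2), IsNewformOf W f →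
          ∀ G : IwasawaAlgebra 2, IsEvenBranchLiftAtTwo W f G → red G ≠ 0) →
        BSDp W 2 →
        ∀ (κ : ZpExtension ℚ 2) (γ : Field.absoluteGaloisGroup ℚ), κ.IsCyclotomic →
          κ.IsTopGenerator γ → IsCyclotomicVariable 2 γ →
          ∀ D : W.SelmerDualData κ γ, D.IsTorsion → D.mu = 0) ↔
      ∀ (W : WeierstrassCurve ℚ) [W.IsElliptic] [W.IsGloballyMinimal], ¬ W.HasCM →
        IsOrdinaryAt W 2 → (∀ x : ℚ, ¬ HasRationalTwoTorsionX W x) → ¬ IsSquare W.Δ →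
        W.analyticRank = 0 →
        (∀ ⦃N : ℕ⦄ [NeZero N] (f : CuspForm (Gamma0 N) 2), IsNewformOf W f →
          ∀ G : IwasawaAlgebra 2, IsEvenBranchLiftAtTwo W f G → red G ≠ 0) →
        BSDp W 2 → O1.KatoMuPartAtTwo W := by
  refine ⟨fun hT W _ _ hcm hord ht hsq hr hμan hbsd => ?_, fun hK W _ _ hcm hord ht hsq hr hμan hbsd => ?_⟩
  · exact katoMuPartAtTwo_of_mu_eq_zero_of_isTorsion W (fun f => h17 W f) hmod hord
      (hT W hcm hord ht hsq hr hμan hbsd)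
  · intro κ γ hκ hγ hγ' D _
    exact mu_eq_zero_of_katoMuPartAtTwo W hper hmod hord ht hμan (hK W hcm hord ht hsq hr hμan hbsd) κ γ hκ hγ
      hγ' D

end Crux

/-! ## §3 Binder-free, per curve: on the rank-`0` `BSD₂` cell the `2`-adic main conjecture IS the `𝔭 = (2)` clause

The crux's analytic `μ₂ = 0` binder is needed in §1 only to turn the `𝔭 = (2)` clause into `μ₂(X) = 0` (stub T of
road (a)). For Mazur's main conjecture itself it is IDLE on this road as well: cell `bsd-2adic`'s `Ш`-currency
engine (`EisensteinShaCurrency.charIdeal_eq_span_iff_mu_le_and_missingLowerBoundAt`: at a datum,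
`char X = (L₀)` iff `μ(X) ≤ μ(L₀)` and `ord₂ #Ш_an ≤ ord₂ #Ш`) closes the main conjecture from the clause and
`BSD(W,2)` whatever the common value `μ(X) = μ(L₀)` is. -/

section BinderFree

variable (W : WeierstrassCurve ℚ) [W.IsElliptic] [W.IsGloballyMinimal]

/-- **Per curve, binder-free**: PRINT (`h17`, `hGr`, `hper`, `hmod`, `hGZK`) + good ordinary `2` + no rational point
of order `2` + `r_an = 0` + `BSD(W,2)` + the `𝔭 = (2)` clause `X5.O1.KatoMuPartAtTwo W` ⟹ `MazurMainConjecture W 2`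
— NO analytic `μ`-hypothesis. Chain: period unit ⟹ Néron integrality (`hint` of
`X5.O1.mainConjectureLowerDivisibilityAtTwoOrd_of_katoMuPartAtTwo`) ⟹ the integral Kato–Néron half; `BSD(W,2)` ⟹
`ord₂ #Ш_an ≤ ord₂ #Ш`; engine `EisensteinShaCurrency.mazurMainConjecture_two_of_katoHalf_of_missingLowerBoundAt`.
[cite: Kato2004Asterisque, Thm. 17.4 (1)(2) (p. 273)] [cite: GreenbergLNM1716, Thm. 4.1 (p. 102)]
[cite: Miller2011LMS, Def. 1.1] -/
theorem mazurMainConjecture_two_of_bsdp_of_katoMuPartAtTwo'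
    (h17 : ∀ [NeZero (W.conductorNorm ℤ)] (f : CuspForm (Gamma0 (W.conductorNorm ℤ)) 2),
      kato_divisibility_allPrimes W 2 (f := f))
    (hGr : Greenberg1999.thm41_charValue_rankZero_anyPrime)
    (hper : realPeriodRat_eq_unit_mul_plusPeriod_two) (hmod : nonempty_modularParametrizationData)
    (hGZK : rank_eq_analyticRank_of_analyticRank_le_one) (hord : IsOrdinaryAt W 2)
    (ht : ∀ x : ℚ, ¬ HasRationalTwoTorsionX W x) (hr : W.analyticRank = 0) (hbsd : BSDp W 2)
    (hK : O1.KatoMuPartAtTwo W) : MazurMainConjecture W 2 := by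
  have hirr : Irr W 2 := irr_two_of_forall_not_hasRationalTwoTorsionX W ht
  have hgo : GoodOrd W 2 := hord
  have hsha : Typed.MissingLowerBoundAt W 2 :=
    missingLowerBoundAt_of_bsdp W hGZK 2 (by rw [hr]; exact zero_le_one) hbsd
  exact EisensteinShaCurrency.mazurMainConjecture_two_of_katoHalf_of_missingLowerBoundAt W h17
    (O1.twoAdicEulerCharRankZero_zero_of_greenberg W hGr) hGZK hmod hgo hr
    (O1.mainConjectureLowerDivisibilityAtTwoOrd_of_katoMuPartAtTwo W h17
      (fun f hf ϖ hϖ => O1.exists_integral_mul_padicLFunction_two_of_padicValRat_nonneg W hord hf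
        (padicValRat_periodRatio_eq_zero_two W hper hord.1 hirr f hf ϖ hϖ).ge) hK) hsha

/-- **Converse, binder-free**: Kato 17.4 (1) at `2` (`h17`, for `X` torsion) + `MazurMainConjecture W 2` ⟹ the
`𝔭 = (2)` clause `X5.O1.KatoMuPartAtTwo W` (`char X = (g)`, `ι g = ϖ·L₂` ⟹ `g ∈ char X` ⟹ `2^{μ(X)} ∣ L₀`; tree
bookkeeping `X5.O1.katoMuPartAtTwo_of_mainConjectureLowerDivisibilityAtTwoOrd`).
[cite: Kato2004Asterisque, Thm. 17.4 (1) (p. 273)] -/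
theorem katoMuPartAtTwo_of_mazurMainConjecture_two
    (h17 : ∀ [NeZero (W.conductorNorm ℤ)] (f : CuspForm (Gamma0 (W.conductorNorm ℤ)) 2),
      kato_divisibility_allPrimes W 2 (f := f))
    (hMC : MazurMainConjecture W 2) : O1.KatoMuPartAtTwo W :=
  O1.katoMuPartAtTwo_of_mainConjectureLowerDivisibilityAtTwoOrd W h17
    (O1.mainConjectureLowerDivisibilityAtTwoOrd_of_mazurMainConjecture W fun _ => hMC)

/-- **Per curve, binder-free: on the rank-`0` `BSD₂` cell, `MazurMainConjecture W 2 ⟺ X5.O1.KatoMuPartAtTwo W`**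
modulo PRINT (`h17`, `hGr`, `hper`, `hmod`, `hGZK`), for `W` good ordinary at `2` with no rational point of order `2`,
`r_an = 0` and `BSD(W,2)`. The `2`-adic main conjecture of a `BSD₂`-certified rank-`0` seed IS Kato's missing
`𝔭 = (2)` clause for that curve — nothing more, nothing less — and no analytic `μ`-hypothesis enters.
[cite: Kato2004Asterisque, Thm. 13.4 (3) (p. 226), Thm. 17.4 (p. 273)] [cite: GreenbergLNM1716, Thm. 4.1 (p. 102)] -/
theorem mazurMainConjecture_two_iff_katoMuPartAtTwo
    (h17 : ∀ [NeZero (W.conductorNorm ℤ)] (f : CuspForm (Gamma0 (W.conductorNorm ℤ)) 2),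
      kato_divisibility_allPrimes W 2 (f := f))
    (hGr : Greenberg1999.thm41_charValue_rankZero_anyPrime)
    (hper : realPeriodRat_eq_unit_mul_plusPeriod_two) (hmod : nonempty_modularParametrizationData)
    (hGZK : rank_eq_analyticRank_of_analyticRank_le_one) (hord : IsOrdinaryAt W 2)
    (ht : ∀ x : ℚ, ¬ HasRationalTwoTorsionX W x) (hr : W.analyticRank = 0) (hbsd : BSDp W 2) :
    MazurMainConjecture W 2 ↔ O1.KatoMuPartAtTwo W :=
  ⟨katoMuPartAtTwo_of_mazurMainConjecture_two W h17,
    mazurMainConjecture_two_of_bsdp_of_katoMuPartAtTwo' W h17 hGr hper hmod hGZK hord ht hr hbsd⟩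

end BinderFree

end Summit.BirchSwinnertonDyer.BirchSwinnertonDyer.Theorems.AlignedTransportAtTwoKatoMuRoad

end
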